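import Summits.HodgeConjecture.HodgeConjecture.Theorems.LinearSystemTorelliLocalTubeSpanUnimodularTransitivityLemmas

/-!
# Route LinearSystemTorelli — crux `LocalTubeSpan` (stmt-HodgeConjecture-2490): the level-2 pair moves along a unimodular vanishing cycle are monodromy

Helper file (`--supports stmt-HodgeConjecture-2490`, line `Sketch` of the crux chain, cycle 8,
continuation lead c7; the lead's stub `stub_pairMovesOfPartners`, worker C).  Cycle 8 discharges the
named fact `Janssen1983_thm2_5` (`Γ_Δ ⊇ Sp♯₂(ℤΔ)`, [Janssen1983] Thm. 2.5 = [Schnell2010] §7 Thm. 10)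
piece by piece; this file supplies, WITHOUT that fact, the first elementary family of the level-2
congruence subgroup at a unimodular vanishing cycle.

Setting: an alternating form `B` on a `ℚ`-space `V`, a skew vanishing lattice `Δ`
(`IsSkewVanishingLattice`, lattice `ℤΔ := Submodule.span ℤ Δ`, monodromy group
`Γ_Δ = transvectionGroup B Δ` generated by the transvections `T_δ v = v - B(v, δ) δ`, `δ ∈ Δ`), and a
unimodular pair `u, w ∈ Δ`, `B(u, w) = 1`.  MAIN THEOREM
`localTubeSpan_pairMoves_of_partnersGenerate`: granting Janssen's Lemma 2.7 at `u` (the lattice `ℤΔ`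
is generated by `u` and the partners `{δ ∈ Δ | B(u, δ) = 1}` — hypothesis `hgen`, proved by the
neighbouring stub `stub_partnersGenerate`), for EVERY `m ∈ ℤΔ` with `B(u, m) = 0` some element of
`Γ_Δ` acts as the squared transvection pair
`E_{u,m}² : v ↦ v + 2 (B(v, u) m + B(v, m) u)`.

Proof.
* SHEARS (`localTubeSpan_pairMoves_shear_mem`): `T_u^{∓k}` acts as `v ↦ v + k B(v, u) u`, `k ∈ ℤ`.
* SIX SQUARES (`localTubeSpan_pairMoves_sixSquares`): for `n ⟂ u, w` with `w + n ∈ Δ`, the cycles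
  `u + w = T_w⁻¹ u` and `u + w + n = T_{w+n}⁻¹ u` lie in `Δ`, the words `T_u² T_w² T_{u+w}²` and
  `T_u² T_{w+n}² T_{u+w+n}²` act as `-1` on the planes `(u, w)`, `(u, w + n)`
  (`localTubeSpan_negOnPlane`), and their product acts as `E_{u,n}²`.
* CLOSURE (`…_zero`, `…_neg`, `…_add`, `…_zsmul`): the set of `x ⟂ u` in `ℤΔ` whose move `E_{u,x}²`
  is realised in `Γ_Δ` contains `0` and is closed under negation (inverse), sums (the Heisenberg law
  `E_{u,x}² E_{u,x'}² = E_{u,x+x'}² ∘ (v ↦ v + 4 B(x', x) B(v, u) u)`, corrected by the shear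
  `T_u^{4B(x',x)}`, `B(x', x) ∈ ℤ` by integrality) and integer multiples.
* GENERATION (`localTubeSpan_pairMoves_proj`): for the projection `π x = x - B(x, w) u + B(x, u) w`
  onto `{u, w}^⊥`, the move along `π x` is realised for every `x` in the span of `u` and the partners:
  `π u = 0`, `π` is additive, and for a partner `δ` one has `w + π δ = δ - B(δ, w) u = T_u^{B(δ,w)} δ ∈ Δ`
  (stability of `Δ`), so the six squares apply.
* CONCLUSION: for `m ⟂ u`, `m = π m + B(m, w) u`, and `E_{u,m}² = T_u^{-4B(m,w)} ∘ E_{u,πm}²`.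

References: [Janssen1983] W. A. M. Janssen, *Skew-symmetric vanishing lattices and their monodromy
groups*, Math. Ann. 266 (1983), Thm. 2.5, Lemma 2.7; [Schnell2010] C. Schnell, *Primitive cohomology
and the tube mapping*, Math. Z. 268 (2010) §7.  No named facts; no `sorry`.
-/

-- `Summit.HodgeConjecture.HodgeConjecture.Theorems` is the mandated namespace (single-conjunct summit:
-- Sub = Summit), which `linter.dupNamespace` flags on every declaration; the lakefile turns the
-- linter off tree-wide (weak option), restated here so stand-alone elaboration is warning-free too.
set_option linter.dupNamespace false

noncomputable section

open Literature.AlgebraicGeometry.HodgeTheory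

namespace Summit.HodgeConjecture.HodgeConjecture.Theorems

variable {V : Type} [AddCommGroup V] [Module ℚ V]

/-! ### Units of the monodromy group: transvections, shears, the `-1` of a unimodular plane -/

section Units

variable (B : LinearMap.BilinForm ℚ V) (hB : B.IsAlt) (Δ : Set V)

include hB in
/-- The transvection `T_δ` along a vanishing cycle `δ ∈ Δ` is (the underlying map of) a unit of
`Γ_Δ`. [folklore] -/
theorem localTubeSpan_pairMoves_unit_mem {δ : V} (hδ : δ ∈ Δ) :
    ∃ t ∈ transvectionGroup B Δ, ((t : (V →ₗ[ℚ] V)ˣ) : V →ₗ[ℚ] V) = skewTransvection B δ :=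
  ⟨LinearMap.GeneralLinearGroup.ofLinearEquiv (skewTransvectionEquiv B (hB.self_eq_zero δ)),
    unit_skewTransvection_mem_transvectionGroup B hδ (hB.self_eq_zero δ), rfl⟩

include hB in
/-- **Integral shears along a vanishing cycle are monodromy**: for `u ∈ Δ` and `k ∈ ℤ` some element
of `Γ_Δ` (the power `T_u^{-k}`) acts as `v ↦ v + k B(v, u) u`. [folklore] -/
theorem localTubeSpan_pairMoves_shear_mem {u : V} (hu : u ∈ Δ) (k : ℤ) :
    ∃ g ∈ transvectionGroup B Δ, ∀ v : V,
      ((g : (V →ₗ[ℚ] V)ˣ) : V →ₗ[ℚ] V) v = v + (k : ℚ) • (B v u • u) := by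
  obtain ⟨tu, htuΓ, htu⟩ := localTubeSpan_pairMoves_unit_mem B hB Δ hu
  induction k using Int.induction_on with
  | zero =>
    exact ⟨1, one_mem _, fun v => by
      rw [Units.val_one, Module.End.one_apply, Int.cast_zero, zero_smul, add_zero]⟩
  | succ i ih =>
    obtain ⟨g, hg, hgv⟩ := ih
    refine ⟨tu⁻¹ * g, mul_mem (inv_mem htuΓ) hg, fun v => ?_⟩
    rw [Units.val_mul, Module.End.mul_apply, hgv,
      localTubeSpan_unit_inv_apply B htu (hB.self_eq_zero u)]
    simp only [map_add, map_smul, LinearMap.add_apply, LinearMap.smul_apply, smul_eq_mul,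
      hB.self_eq_zero u, mul_zero, add_zero]
    push_cast
    module
  | pred i ih =>
    obtain ⟨g, hg, hgv⟩ := ih
    refine ⟨tu * g, mul_mem htuΓ hg, fun v => ?_⟩
    rw [Units.val_mul, Module.End.mul_apply, hgv, htu, skewTransvection_apply]
    simp only [map_add, map_smul, LinearMap.add_apply, LinearMap.smul_apply, smul_eq_mul,
      hB.self_eq_zero u, mul_zero, add_zero]
    push_cast
    module

include hB in
/-- For vanishing cycles `u, y ∈ Δ` with `B(u, y) = 1`, the vector `u + y = T_y⁻¹ u` is a vanishing
cycle (stability of `Δ` under `Γ_Δ`). [folklore] -/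
theorem localTubeSpan_pairMoves_add_mem (hΔ : IsSkewVanishingLattice B Δ) {u y : V} (hu : u ∈ Δ)
    (hy : y ∈ Δ) (huy : B u y = 1) : u + y ∈ Δ := by
  obtain ⟨ty, htyΓ, hty⟩ := localTubeSpan_pairMoves_unit_mem B hB Δ hy
  have h := hΔ.stable _ (inv_mem htyΓ) u hu
  rwa [localTubeSpan_unit_inv_apply B hty (hB.self_eq_zero y), huy, one_smul] at h

include hB in
/-- **The `-1` of a unimodular plane of vanishing cycles is monodromy**: for `u, y ∈ Δ` with
`B(u, y) = 1` the word `T_u² T_y² T_{u+y}² ∈ Γ_Δ` acts as `v ↦ v - 2 (B(v, y) u - B(v, u) y)`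
(`-1` on `ℚu ⊕ ℚy`, the identity on its `B`-orthogonal). [folklore] -/
theorem localTubeSpan_pairMoves_negOnPlane_mem (hΔ : IsSkewVanishingLattice B Δ) {u y : V}
    (hu : u ∈ Δ) (hy : y ∈ Δ) (huy : B u y = 1) :
    ∃ z ∈ transvectionGroup B Δ, ∀ v : V,
      ((z : (V →ₗ[ℚ] V)ˣ) : V →ₗ[ℚ] V) v = v - (2 : ℚ) • (B v y • u - B v u • y) := by
  obtain ⟨tu, htuΓ, htu⟩ := localTubeSpan_pairMoves_unit_mem B hB Δ hu
  obtain ⟨ty, htyΓ, hty⟩ := localTubeSpan_pairMoves_unit_mem B hB Δ hy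
  obtain ⟨tuy, htuyΓ, htuy⟩ := localTubeSpan_pairMoves_unit_mem B hB Δ
    (localTubeSpan_pairMoves_add_mem B hB Δ hΔ hu hy huy)
  refine ⟨tu * tu * (ty * ty) * (tuy * tuy),
    mul_mem (mul_mem (mul_mem htuΓ htuΓ) (mul_mem htyΓ htyΓ)) (mul_mem htuyΓ htuyΓ), fun v => ?_⟩
  simp only [Units.val_mul, Module.End.mul_apply, htu, hty, htuy]
  exact localTubeSpan_negOnPlane B hB huy v

end Units

/-! ### The realised pair moves `E_{u,x}²`: six squares and closure properties -/

section Moves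

variable (B : LinearMap.BilinForm ℚ V) (hB : B.IsAlt) (Δ : Set V)

include hB in
/-- **Six squares.**  For a unimodular pair of vanishing cycles `u, w` (`B(u, w) = 1`) and a vector
`n` orthogonal to both with `w + n ∈ Δ`, the product of the `-1`'s of the planes `(u, w)` and
`(u, w + n)` — the word `T_u² T_w² T_{u+w}² · T_u² T_{w+n}² T_{u+w+n}²` of `Γ_Δ` — acts as the pair
move `E_{u,n}² : v ↦ v + 2 (B(v, u) n + B(v, n) u)`. [folklore] -/
theorem localTubeSpan_pairMoves_sixSquares (hΔ : IsSkewVanishingLattice B Δ) {u w n : V}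
    (hu : u ∈ Δ) (hw : w ∈ Δ) (huw : B u w = 1) (hun : B u n = 0) (hwn : B w n = 0)
    (hwnΔ : w + n ∈ Δ) :
    ∃ g ∈ transvectionGroup B Δ, ∀ v : V,
      ((g : (V →ₗ[ℚ] V)ˣ) : V →ₗ[ℚ] V) v = v + (2 : ℚ) • (B v u • n + B v n • u) := by
  have huwn : B u (w + n) = 1 := by rw [map_add, huw, hun, add_zero]
  obtain ⟨z, hz, hzv⟩ := localTubeSpan_pairMoves_negOnPlane_mem B hB Δ hΔ hu hw huw
  obtain ⟨z', hz', hz'v⟩ := localTubeSpan_pairMoves_negOnPlane_mem B hB Δ hΔ hu hwnΔ huwn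
  refine ⟨z * z', mul_mem hz hz', fun v => ?_⟩
  rw [Units.val_mul, Module.End.mul_apply, hz'v, hzv]
  have hwu : B w u = -1 := by rw [← hB.neg_eq, huw]
  have hnu : B n u = 0 := by rw [← hB.neg_eq, hun, neg_zero]
  have hnw : B n w = 0 := by rw [← hB.neg_eq, hwn, neg_zero]
  simp only [map_sub, map_smul, map_add, LinearMap.sub_apply, LinearMap.smul_apply,
    LinearMap.add_apply, smul_eq_mul, huw, hwu, hnu, hnw, hB.self_eq_zero]
  module

/-- The trivial pair move `E_{u,0}² = 1` is realised in `Γ_Δ`. [folklore] -/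
theorem localTubeSpan_pairMoves_zero (u : V) :
    ∃ g ∈ transvectionGroup B Δ, ∀ v : V,
      ((g : (V →ₗ[ℚ] V)ˣ) : V →ₗ[ℚ] V) v = v + (2 : ℚ) • (B v u • (0 : V) + B v (0 : V) • u) :=
  ⟨1, one_mem _, fun v => by
    rw [Units.val_one, Module.End.one_apply, map_zero, zero_smul, smul_zero, add_zero, smul_zero,
      add_zero]⟩

include hB in
/-- Realised pair moves are closed under negation: for `x ⟂ u` the inverse of an element acting as
`E_{u,x}²` acts as `E_{u,-x}²` (`E_{u,x}² = 1 + 2M` with `M² = 0`). [folklore] -/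
theorem localTubeSpan_pairMoves_neg {u x : V} (hux : B u x = 0)
    (hP : ∃ g ∈ transvectionGroup B Δ, ∀ v : V,
      ((g : (V →ₗ[ℚ] V)ˣ) : V →ₗ[ℚ] V) v = v + (2 : ℚ) • (B v u • x + B v x • u)) :
    ∃ g ∈ transvectionGroup B Δ, ∀ v : V,
      ((g : (V →ₗ[ℚ] V)ˣ) : V →ₗ[ℚ] V) v = v + (2 : ℚ) • (B v u • (-x) + B v (-x) • u) := by
  obtain ⟨g, hg, hgv⟩ := hP
  have hxu : B x u = 0 := by rw [← hB.neg_eq, hux, neg_zero]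
  refine ⟨g⁻¹, inv_mem hg, fun v => ?_⟩
  have h1 : (g : V →ₗ[ℚ] V) (v + (2 : ℚ) • (B v u • (-x) + B v (-x) • u)) = v := by
    rw [hgv]
    simp only [map_add, map_smul, map_neg, LinearMap.add_apply, LinearMap.smul_apply,
      LinearMap.neg_apply, smul_eq_mul, hux, hxu, hB.self_eq_zero]
    module
  calc ((g⁻¹ : (V →ₗ[ℚ] V)ˣ) : V →ₗ[ℚ] V) v
      = ((g⁻¹ : (V →ₗ[ℚ] V)ˣ) : V →ₗ[ℚ] V)
          ((g : V →ₗ[ℚ] V) (v + (2 : ℚ) • (B v u • (-x) + B v (-x) • u))) := by rw [h1]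
    _ = v + (2 : ℚ) • (B v u • (-x) + B v (-x) • u) := localTubeSpan_units_inv_apply_apply g _

include hB in
/-- Realised pair moves are closed under sums (the Heisenberg law): for `x, x' ∈ ℤΔ` orthogonal to
`u ∈ Δ`, if elements of `Γ_Δ` act as `E_{u,x}²` and `E_{u,x'}²`, then their product acts as
`E_{u,x+x'}²` followed by `v ↦ v + 4 B(x', x) B(v, u) u`, and `B(x', x) ∈ ℤ`, so composing with the
shear `T_u^{4 B(x', x)} ∈ Γ_Δ` realises `E_{u,x+x'}²`. [folklore] -/
theorem localTubeSpan_pairMoves_add (hint : ∀ δ ∈ Δ, ∀ δ' ∈ Δ, ∃ n : ℤ, B δ δ' = n) {u x x' : V}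
    (hu : u ∈ Δ) (hx : x ∈ Submodule.span ℤ Δ) (hx' : x' ∈ Submodule.span ℤ Δ) (hux : B u x = 0)
    (hux' : B u x' = 0)
    (hP : ∃ g ∈ transvectionGroup B Δ, ∀ v : V,
      ((g : (V →ₗ[ℚ] V)ˣ) : V →ₗ[ℚ] V) v = v + (2 : ℚ) • (B v u • x + B v x • u))
    (hP' : ∃ g ∈ transvectionGroup B Δ, ∀ v : V,
      ((g : (V →ₗ[ℚ] V)ˣ) : V →ₗ[ℚ] V) v = v + (2 : ℚ) • (B v u • x' + B v x' • u)) :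
    ∃ g ∈ transvectionGroup B Δ, ∀ v : V,
      ((g : (V →ₗ[ℚ] V)ˣ) : V →ₗ[ℚ] V) v = v + (2 : ℚ) • (B v u • (x + x') + B v (x + x') • u) := by
  obtain ⟨g, hg, hgv⟩ := hP
  obtain ⟨g', hg', hg'v⟩ := hP'
  obtain ⟨β, hβ⟩ := localTubeSpan_integral_span B Δ hint hx' hx
  obtain ⟨c, hc, hcv⟩ := localTubeSpan_pairMoves_shear_mem B hB Δ hu (-(4 * β))
  have hxu : B x u = 0 := by rw [← hB.neg_eq, hux, neg_zero]
  have hx'u : B x' u = 0 := by rw [← hB.neg_eq, hux', neg_zero]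
  refine ⟨c * (g * g'), mul_mem hc (mul_mem hg hg'), fun v => ?_⟩
  rw [Units.val_mul, Units.val_mul, Module.End.mul_apply, Module.End.mul_apply, hg'v, hgv, hcv]
  simp only [map_add, map_smul, LinearMap.add_apply, LinearMap.smul_apply, smul_eq_mul, hux, hxu,
    hx'u, hB.self_eq_zero, hβ]
  push_cast
  module

include hB in
/-- Realised pair moves are closed under integer multiples: for `x ∈ ℤΔ` orthogonal to `u ∈ Δ`, if
`E_{u,x}²` is realised in `Γ_Δ` then so is `E_{u,kx}²` for every `k ∈ ℤ`. [folklore] -/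
theorem localTubeSpan_pairMoves_zsmul (hint : ∀ δ ∈ Δ, ∀ δ' ∈ Δ, ∃ n : ℤ, B δ δ' = n) {u x : V}
    (hu : u ∈ Δ) (hx : x ∈ Submodule.span ℤ Δ) (hux : B u x = 0)
    (hP : ∃ g ∈ transvectionGroup B Δ, ∀ v : V,
      ((g : (V →ₗ[ℚ] V)ˣ) : V →ₗ[ℚ] V) v = v + (2 : ℚ) • (B v u • x + B v x • u)) (k : ℤ) :
    ∃ g ∈ transvectionGroup B Δ, ∀ v : V,
      ((g : (V →ₗ[ℚ] V)ˣ) : V →ₗ[ℚ] V) v = v + (2 : ℚ) • (B v u • (k • x) + B v (k • x) • u) := by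
  have hukx : ∀ j : ℤ, B u (j • x) = 0 := fun j => by rw [map_zsmul, hux, smul_zero]
  induction k using Int.induction_on with
  | zero =>
    rw [zero_smul]
    exact localTubeSpan_pairMoves_zero B Δ u
  | succ i ih =>
    rw [add_smul, one_smul]
    exact localTubeSpan_pairMoves_add B hB Δ hint hu (Submodule.smul_mem _ _ hx) hx (hukx _) hux
      ih hP
  | pred i ih =>
    rw [sub_smul, one_smul, sub_eq_add_neg]
    exact localTubeSpan_pairMoves_add B hB Δ hint hu (Submodule.smul_mem _ _ hx)
      (Submodule.neg_mem _ hx) (hukx _) (by rw [map_neg, hux, neg_zero]) ih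
      (localTubeSpan_pairMoves_neg B hB Δ hux hP)

end Moves

/-! ### Generation from the partners of `u`, and the main theorem -/

section Generation

variable (B : LinearMap.BilinForm ℚ V) (hB : B.IsAlt) (Δ : Set V)

include hB in
/-- **Generation.**  For a unimodular pair of vanishing cycles `u, w` (`B(u, w) = 1`) and the
projection `π x = x - B(x, w) u + B(x, u) w` of `V` onto the `B`-orthogonal of the plane `(u, w)`,
the pair move `E_{u,πx}²` is realised in `Γ_Δ` for every `x` in the `ℤ`-span of `u` and the partners
`{δ ∈ Δ | B(u, δ) = 1}` of `u`: `π u = 0`; for a partner `δ`, `w + π δ = δ - B(δ, w) u = T_u^{B(δ,w)} δ`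
is a vanishing cycle, so the six squares realise `E_{u,πδ}²`; and the realised moves are closed under
sums and integer multiples. [folklore] -/
theorem localTubeSpan_pairMoves_proj (hΔ : IsSkewVanishingLattice B Δ) {u w : V} (hu : u ∈ Δ)
    (hw : w ∈ Δ) (huw : B u w = 1) {x : V}
    (hx : x ∈ Submodule.span ℤ (insert u {δ ∈ Δ | B u δ = 1})) :
    ∃ g ∈ transvectionGroup B Δ, ∀ v : V,
      ((g : (V →ₗ[ℚ] V)ˣ) : V →ₗ[ℚ] V) v =
        v + (2 : ℚ) • (B v u • (x - B x w • u + B x u • w) + B v (x - B x w • u + B x u • w) • u) := by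
  have hsub : insert u {δ ∈ Δ | B u δ = 1} ⊆ Δ := Set.insert_subset hu fun δ hδ => hδ.1
  have hwu : B w u = -1 := by rw [← hB.neg_eq, huw]
  -- the projection is orthogonal to `u` and `w`
  have hπu : ∀ x : V, B u (x - B x w • u + B x u • w) = 0 := fun x => by
    simp only [map_add, map_sub, map_smul, smul_eq_mul, hB.self_eq_zero, huw]
    rw [← hB.neg_eq x u]
    ring
  have hπw : ∀ x : V, B w (x - B x w • u + B x u • w) = 0 := fun x => by
    simp only [map_add, map_sub, map_smul, smul_eq_mul, hB.self_eq_zero, hwu]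
    rw [← hB.neg_eq x w]
    ring
  -- the projection preserves the lattice
  have hπmem : ∀ x ∈ Submodule.span ℤ Δ, x - B x w • u + B x u • w ∈ Submodule.span ℤ Δ := by
    intro x hx
    obtain ⟨a, ha⟩ := localTubeSpan_integral_span B Δ hΔ.integral hx (Submodule.subset_span hw)
    obtain ⟨b, hb⟩ := localTubeSpan_integral_span B Δ hΔ.integral hx (Submodule.subset_span hu)
    rw [ha, hb]
    exact Submodule.add_mem _ (Submodule.sub_mem _ hx
      (localTubeSpan_intCast_smul_mem Δ (Submodule.subset_span hu) a))
      (localTubeSpan_intCast_smul_mem Δ (Submodule.subset_span hw) b)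
  induction hx using Submodule.span_induction with
  | mem x hx =>
    rcases hx with hxeq | ⟨hxΔ, hux⟩
    · -- `π u = 0`
      have h0 : x - B x w • u + B x u • w = 0 := by
        rw [hxeq, huw, hB.self_eq_zero, one_smul, zero_smul, sub_self, add_zero]
      rw [h0]
      exact localTubeSpan_pairMoves_zero B Δ u
    · -- a partner `δ = x`: `w + π δ = δ - B(δ, w) u ∈ Δ`, then the six squares
      obtain ⟨α, hα⟩ := hΔ.integral x hxΔ w hw
      obtain ⟨c, hc, hcv⟩ := localTubeSpan_pairMoves_shear_mem B hB Δ hu α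
      have hxu : B x u = -1 := by rw [← hB.neg_eq, hux]
      have hmem : w + (x - B x w • u + B x u • w) ∈ Δ := by
        have h := hΔ.stable c hc x hxΔ
        rw [hcv, hxu] at h
        convert h using 1
        rw [hα, hxu]
        module
      exact localTubeSpan_pairMoves_sixSquares B hB Δ hΔ hu hw huw (hπu x) (hπw x) hmem
  | zero =>
    have h0 : (0 : V) - B (0 : V) w • u + B (0 : V) u • w = 0 := by
      rw [map_zero, LinearMap.zero_apply, LinearMap.zero_apply, zero_smul, zero_smul, sub_zero,
        add_zero]
    rw [h0]
    exact localTubeSpan_pairMoves_zero B Δ u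
  | add x y hx hy ihx ihy =>
    have hadd : x + y - B (x + y) w • u + B (x + y) u • w =
        (x - B x w • u + B x u • w) + (y - B y w • u + B y u • w) := by
      simp only [map_add, LinearMap.add_apply]
      module
    rw [hadd]
    exact localTubeSpan_pairMoves_add B hB Δ hΔ.integral hu (hπmem x (Submodule.span_mono hsub hx))
      (hπmem y (Submodule.span_mono hsub hy)) (hπu x) (hπu y) ihx ihy
  | smul k x hx ih =>
    have hsmul : k • x - B (k • x) w • u + B (k • x) u • w = k • (x - B x w • u + B x u • w) := by
      simp only [← Int.cast_smul_eq_zsmul ℚ k, map_smul, LinearMap.smul_apply, smul_eq_mul]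
      module
    rw [hsmul]
    exact localTubeSpan_pairMoves_zsmul B hB Δ hΔ.integral hu
      (hπmem x (Submodule.span_mono hsub hx)) (hπu x) ih k

end Generation

/-- **The level-2 pair moves along a unimodular vanishing cycle lie in the monodromy group**
(worker C's stub `stub_pairMovesOfPartners` of line `Sketch`, cycle 8; the first elementary family
of Janssen's `Sp♯₂(ℤΔ) ≤ Γ_Δ`, obtained here WITHOUT Theorem 2.5).  Let `Δ` be a skew vanishing
lattice of the alternating form `B`, `u, w ∈ Δ` with `B(u, w) = 1`, and grant Janssen's Lemma 2.7 at
`u`: `ℤΔ` is spanned by `u` and the partners `{δ ∈ Δ | B(u, δ) = 1}`.  Then for every `m ∈ ℤΔ` with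
`B(u, m) = 0` some element of `Γ_Δ` acts as `E_{u,m}² : v ↦ v + 2 (B(v, u) m + B(v, m) u)`.
(`m = π m + B(m, w) u` with `π` the projection onto `{u, w}^⊥`; the move along `π m` is realised by
`localTubeSpan_pairMoves_proj`, and `E_{u,m}² = T_u^{-4B(m,w)} ∘ E_{u,πm}²`.)
[cite: Janssen1983, Thm. 2.5] -/
theorem localTubeSpan_pairMoves_of_partnersGenerate (B : LinearMap.BilinForm ℚ V) (hB : B.IsAlt)
    (Δ : Set V) (hΔ : IsSkewVanishingLattice B Δ) {u w : V} (hu : u ∈ Δ) (hw : w ∈ Δ)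
    (huw : B u w = 1)
    (hgen : Submodule.span ℤ (insert u {δ ∈ Δ | B u δ = 1}) = Submodule.span ℤ Δ)
    {m : V} (hm : m ∈ Submodule.span ℤ Δ) (hum : B u m = 0) :
    ∃ g ∈ transvectionGroup B Δ, ∀ v : V,
      ((g : (V →ₗ[ℚ] V)ˣ) : V →ₗ[ℚ] V) v = v + (2 : ℚ) • (B v u • m + B v m • u) := by
  have hm' : m ∈ Submodule.span ℤ (insert u {δ ∈ Δ | B u δ = 1}) := by rwa [hgen]
  obtain ⟨g, hg, hgv⟩ := localTubeSpan_pairMoves_proj B hB Δ hΔ hu hw huw hm'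
  obtain ⟨β, hβ⟩ := localTubeSpan_integral_span B Δ hΔ.integral hm (Submodule.subset_span hw)
  obtain ⟨c, hc, hcv⟩ := localTubeSpan_pairMoves_shear_mem B hB Δ hu (4 * β)
  have hmu : B m u = 0 := by rw [← hB.neg_eq, hum, neg_zero]
  have hwu : B w u = -1 := by rw [← hB.neg_eq, huw]
  refine ⟨c * g, mul_mem hc hg, fun v => ?_⟩
  rw [Units.val_mul, Module.End.mul_apply, hgv, hcv]
  simp only [map_add, map_sub, map_smul, LinearMap.add_apply, LinearMap.sub_apply,
    LinearMap.smul_apply, smul_eq_mul, hβ, hmu, hwu, hB.self_eq_zero]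
  push_cast
  module

end Summit.HodgeConjecture.HodgeConjecture.Theorems

end
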